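import Summits.BirchSwinnertonDyer.BirchSwinnertonDyer.Theorems.EisensteinDepletionAtTwoStarLocalGlue
import HarnessLib

/-!
# The glue item `DepletedLambdaLawAtTwoModNSFOfStar` of route `EisensteinDepletionAtTwo` — E1M_NSF ⇐ (★-GO₂^Σ) ∧ (★-OptB_NSF) — and
# the star split of E1M for a crux RESTRICTED to any class of carriers

Item stmt-BirchSwinnertonDyer-27048 (support, GLUE of the gen-1 split of the re-targeted crux E1M_NSF `DepletedLambdaLawAtTwoModNSF`,
item stmt-BirchSwinnertonDyer-27021, tenure planner p2 GEN 30, route rev 19): `StarGO2Sigma → StarOptBNSF → DepletedLambdaLawAtTwoModNSF`,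
PROVED here as `depletedLambdaLawAtTwoModNSFOfStar_proof` (lead `bsd-rank2-star-p1` GEN 6), from the POINTWISE star glue
`depletedLambdaLawAtTwoAt_of_star` of the companion file `EisensteinDepletionAtTwoStarLocalGlue.lean`: fix a carrier `W` of non-squarefree
conductor, feed (★-GO₂^Σ) at `W` and (★-OptB_NSF) at `W` (its extra binder discharged by `¬ Squarefree N_W`), read off E1 at `W`.  The
modularity antecedent of E1M_NSF is not used (as in p611861).

Also recorded (all one-liners over the pointwise glue): `depletedLambdaLawAtTwoOn_of_star` — for an ARBITRARY predicate `P` on curves, the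
two children with `P W →` inserted after the carrier's binders give E1 with the same insertion; `depletedLambdaLawAtTwoModNSF_of_starNSF` —
E1M_NSF by name from the bodies of the two route children; `starGO2Sigma_iff` (route child 27046 = the Theorems def of p611861, `Iff.rfl`),
`starOptBNSF_of_starOptB` (aside 24445 ⇒ child 27047), `depletedLambdaLawAtTwoModNSF_of_depletedLambdaLawAtTwoMod` (aside E1M 20341 ⇒ crux
27021), `depletedLambdaLawAtTwoMod_of_starGO2Sigma'` (`P = ⊤` recovers p611861: the binder orders are those of the route items).

WHY THE RESTRICTION (tenure p2 GEN 30): the route's leaf family has `N = 3·5·m·q²·r`, never squarefree, and the cell's paper chain — THEOREM A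
(a ℚ-rational `2`-torsion point of `J₀(N)`, `N` odd, formal at `2` lies in the Shimura subgroup; unbounded denominators on `X_μ(N)` +
Wohlfahrt), `U_p = p` on `Σ_N` with `a_p = 0` at `p² ∣ N`, THEOREM B — settles exactly the non-squarefree case of both children ON PAPER.
HONEST FRAMING: glue on an OPEN crux; nothing here proves `StarGO2Sigma`, `StarOptBNSF`, E1M_NSF or BSD; nothing reads an analytic rank.
References: R. Greenberg, V. Vatsal, Invent. Math. 142 (2000) §3 Thm. (3.12), display (28) [GreenbergVatsal2000]; V. Vatsal, J. Inst. Math.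
Jussieu 4 (2005) §1.5 [Vatsal2005]; B. Mazur, J. Tate, J. Teitelbaum, Invent. Math. 84 (1986) §I.10–I.13 [MazurTateTeitelbaum1986Invent].
-/

set_option linter.dupNamespace false
set_option autoImplicit false

noncomputable section

open scoped Classical
open scoped MatrixGroups
open _root_.WeierstrassCurve
open Literature.NumberTheory.EllipticCurves
open Literature.NumberTheory.EllipticCurves.GreenbergVatsal2000
open Literature.NumberTheory.EllipticCurves.Greenberg1999
open Literature.NumberTheory.EllipticCurves.ModularForms
open Summit.BirchSwinnertonDyer.Rank1Residual.X1

namespace Summit.BirchSwinnertonDyer.BirchSwinnertonDyer.Theorems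

namespace DepletionAtTwo

/-! ## §1. The glue for a crux restricted to ANY class `P` of carriers -/

/-- **RESTRICTED GLUE: for ANY predicate `P` on Weierstrass curves, the two children of the star split restricted to the carriers in
`P` give E1 `DepletedLambdaLawAtTwo` restricted to the carriers in `P`.**  The three displayed statements are the bodies of
`StarGO2Sigma` (p611861 / route item 27046), `StarOptB` (aside 24445) and `DepletedLambdaLawAtTwo` (aside 20237) with `P W →` inserted
after the carrier's binders. [cite: GreenbergVatsal2000, §3 Thm. (3.12), display (28)] [cite: Vatsal2005, Thm. 1.1, §1.5] -/
theorem depletedLambdaLawAtTwoOn_of_star (P : WeierstrassCurve ℚ → Prop)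
    (hG : ∀ (W : WeierstrassCurve ℚ) [W.IsElliptic] [W.IsGloballyMinimal], P W →
      ∀ (W₀ : WeierstrassCurve ℚ) [W₀.IsElliptic] [W₀.IsGloballyMinimal]
      ⦃N : ℕ⦄ [NeZero N] (f : CuspForm (CongruenceSubgroup.Gamma0 N) 2), IsNewformOf W f → IsNewformOf W₀ f → IsOrdinaryAt W 2 →
      ∀ (L₀ : PeriodPair), IsNeronLatticeOf (W₀.baseChange ℂ) L₀ → ∀ (q : ℚ), q ≠ 0 →
      (∀ z ∈ periodLattice f, (q : ℂ) * z ∈ L₀.lattice) → (∀ z ∈ L₀.lattice, ∃ w ∈ periodLattice f, z = (q : ℂ) * w) →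
      ∀ (x₀ : ℚ), HasRationalTwoTorsionX W₀ x₀ → ¬ TwoTorsionRamifiedAtTwo x₀ →
      ∀ (lam : ℂ), lam ∈ L₀.lattice → lam / 2 ∉ L₀.lattice → L₀.weierstrassP (lam / 2) - ((W₀.b₂ : ℚ) : ℂ) / 12 = ((x₀ : ℚ) : ℂ) →
      (∃ β : ℕ → ℕ, IsAdmissibleStabData (W.conductorNorm ℤ) β) →
      ∃ β : ℕ → ℕ, IsAdmissibleStabData (W.conductorNorm ℤ) β ∧ ∃ g' : ℚ, g' ≠ 0 ∧ ∃ e : ℤ → ℤ,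
      (∀ b d : ℤ, 0 < d → Int.gcd d (b * (W.conductorNorm ℤ : ℕ)) = 1 →
      ∃ n' : ℤ, stabEisensteinPeriod (W.conductorNorm ℤ) β (Int.gcdA d (b * (W.conductorNorm ℤ : ℕ))) b
      (-((W.conductorNorm ℤ : ℕ) : ℤ) * Int.gcdB d (b * (W.conductorNorm ℤ : ℕ))) d = n' * g' ∧
      (Even n' ↔ ((∃ k : ℤ, ∃ w ∈ L₀.lattice,
      (q : ℂ) * (modularSymbol f ((b : ℚ) / (d : ℚ)) - modularSymbol f 0) = (k : ℂ) * lam + 2 * w) ↔ Even (e d)))) ∧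
      (∃ b d : ℤ, 0 < d ∧ Int.gcd d (b * (W.conductorNorm ℤ : ℕ)) = 1 ∧
      ∃ n' : ℤ, stabEisensteinPeriod (W.conductorNorm ℤ) β (Int.gcdA d (b * (W.conductorNorm ℤ : ℕ))) b
      (-((W.conductorNorm ℤ : ℕ) : ℤ) * Int.gcdB d (b * (W.conductorNorm ℤ : ℕ))) d = n' * g' ∧ Odd n'))
    (hO : ∀ (W : WeierstrassCurve ℚ) [W.IsElliptic] [W.IsGloballyMinimal], P W →
      ∀ (x : ℚ), IsOrdinaryAt W 2 → HasUniqueRationalTwoTorsionX W x →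
      ((TwoTorsionRamifiedAtTwo x ∧ ¬ TwoTorsionOdd W x) ∨ (TwoTorsionOdd W x ∧ ¬ TwoTorsionRamifiedAtTwo x)) →
      W.conductorNorm ℤ ≠ 15 →
      ∀ ⦃N : ℕ⦄ [NeZero N] (f : CuspForm (CongruenceSubgroup.Gamma0 N) 2), IsNewformOf W f →
      ∀ (W₀ : WeierstrassCurve ℚ) [W₀.IsElliptic] [W₀.IsGloballyMinimal], IsNewformOf W₀ f →
      ∀ (L₀ : PeriodPair), IsNeronLatticeOf (W₀.baseChange ℂ) L₀ → ∀ (q : ℚ), q ≠ 0 →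
      (∀ z ∈ periodLattice f, (q : ℂ) * z ∈ L₀.lattice) → (∀ z ∈ L₀.lattice, ∃ w ∈ periodLattice f, z = (q : ℂ) * w) →
      ∃ x₀ : ℚ, HasRationalTwoTorsionX W₀ x₀ ∧ TwoTorsionOdd W₀ x₀ ∧ ¬ TwoTorsionRamifiedAtTwo x₀) :
    ∀ (W : WeierstrassCurve ℚ) [W.IsElliptic] [W.IsGloballyMinimal], P W →
      ∀ (x : ℚ), IsOrdinaryAt W 2 → HasUniqueRationalTwoTorsionX W x →
      ((TwoTorsionRamifiedAtTwo x ∧ ¬ TwoTorsionOdd W x) ∨ (TwoTorsionOdd W x ∧ ¬ TwoTorsionRamifiedAtTwo x)) →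
      ∀ ⦃N : ℕ⦄ [NeZero N] (f : CuspForm (CongruenceSubgroup.Gamma0 N) 2), IsNewformOf W f →
      ∀ (c : ℚ) (L₀ : IwasawaAlgebra 2), L₀ ≠ 0 →
      iwasawaToPowerSeries 2 L₀ = PowerSeries.C (c : ℚ_[2]) * padicLFunction f (unitRoot W 2 : ℚ_[2]) →
      ∀ (S : Finset ℕ), (∀ ℓ ∈ S, Nat.Prime ℓ) → (∀ ℓ : ℕ, Nat.Prime ℓ → ℓ ∣ W.conductorNorm ℤ → ℓ ∈ S) →
      MuLambda.lam (L₀ * ∏ ℓ ∈ S, (if h : Nat.Prime ℓ ∧ ℓ ≠ 2 then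
      eulerFactorElement W 2 ((Rat.HeightOneSpectrum.primesEquiv (R := NumberField.RingOfIntegers ℚ)).symm ⟨ℓ, h.1⟩)
      else 1)) + 2 =
      ∑ ℓ ∈ S.filter (· ≠ 2), 2 ^ (padicValNat 2 ((ℓ ^ 2 - 1) / 8) + 1) :=
  fun W _ _ hP ↦ depletedLambdaLawAtTwoAt_of_star W (hG W hP) (hO W hP)

/-! ## §2. The re-targeted crux E1M_NSF (item 27021) and its split (items 27046, 27047, glue 27048) BY NAME -/

/-- **E1M_NSF BY NAME from the bodies of its two route children**: (★-GO₂^Σ) `StarGO2Sigma` (unrestricted, item 27046) and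
(★-OptB_NSF) `StarOptBNSF` (item 27047: `StarOptB` with the binder `¬ Squarefree N_W` right after `N_W ≠ 15`) give the route item
`DepletedLambdaLawAtTwoModNSF` (item 27021) — pointwise: at a carrier `W` with `¬ Squarefree N_W` feed both children at `W` to
`depletedLambdaLawAtTwoAt_of_star`; the modularity antecedent is unused. [cite: GreenbergVatsal2000, §3 Thm. (3.12), display (28)]
[cite: Vatsal2005, Thm. 1.1, §1.5] -/
theorem depletedLambdaLawAtTwoModNSF_of_starNSF
    (hG : ∀ (W : WeierstrassCurve ℚ) [W.IsElliptic] [W.IsGloballyMinimal] (W₀ : WeierstrassCurve ℚ) [W₀.IsElliptic] [W₀.IsGloballyMinimal]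
      ⦃N : ℕ⦄ [NeZero N] (f : CuspForm (CongruenceSubgroup.Gamma0 N) 2), IsNewformOf W f → IsNewformOf W₀ f → IsOrdinaryAt W 2 →
      ∀ (L₀ : PeriodPair), IsNeronLatticeOf (W₀.baseChange ℂ) L₀ → ∀ (q : ℚ), q ≠ 0 →
      (∀ z ∈ periodLattice f, (q : ℂ) * z ∈ L₀.lattice) → (∀ z ∈ L₀.lattice, ∃ w ∈ periodLattice f, z = (q : ℂ) * w) →
      ∀ (x₀ : ℚ), HasRationalTwoTorsionX W₀ x₀ → ¬ TwoTorsionRamifiedAtTwo x₀ →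
      ∀ (lam : ℂ), lam ∈ L₀.lattice → lam / 2 ∉ L₀.lattice → L₀.weierstrassP (lam / 2) - ((W₀.b₂ : ℚ) : ℂ) / 12 = ((x₀ : ℚ) : ℂ) →
      (∃ β : ℕ → ℕ, IsAdmissibleStabData (W.conductorNorm ℤ) β) →
      ∃ β : ℕ → ℕ, IsAdmissibleStabData (W.conductorNorm ℤ) β ∧ ∃ g' : ℚ, g' ≠ 0 ∧ ∃ e : ℤ → ℤ,
      (∀ b d : ℤ, 0 < d → Int.gcd d (b * (W.conductorNorm ℤ : ℕ)) = 1 →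
      ∃ n' : ℤ, stabEisensteinPeriod (W.conductorNorm ℤ) β (Int.gcdA d (b * (W.conductorNorm ℤ : ℕ))) b
      (-((W.conductorNorm ℤ : ℕ) : ℤ) * Int.gcdB d (b * (W.conductorNorm ℤ : ℕ))) d = n' * g' ∧
      (Even n' ↔ ((∃ k : ℤ, ∃ w ∈ L₀.lattice,
      (q : ℂ) * (modularSymbol f ((b : ℚ) / (d : ℚ)) - modularSymbol f 0) = (k : ℂ) * lam + 2 * w) ↔ Even (e d)))) ∧
      (∃ b d : ℤ, 0 < d ∧ Int.gcd d (b * (W.conductorNorm ℤ : ℕ)) = 1 ∧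
      ∃ n' : ℤ, stabEisensteinPeriod (W.conductorNorm ℤ) β (Int.gcdA d (b * (W.conductorNorm ℤ : ℕ))) b
      (-((W.conductorNorm ℤ : ℕ) : ℤ) * Int.gcdB d (b * (W.conductorNorm ℤ : ℕ))) d = n' * g' ∧ Odd n'))
    (hO : ∀ (W : WeierstrassCurve ℚ) [W.IsElliptic] [W.IsGloballyMinimal] (x : ℚ), IsOrdinaryAt W 2 → HasUniqueRationalTwoTorsionX W x →
      ((TwoTorsionRamifiedAtTwo x ∧ ¬ TwoTorsionOdd W x) ∨ (TwoTorsionOdd W x ∧ ¬ TwoTorsionRamifiedAtTwo x)) →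
      W.conductorNorm ℤ ≠ 15 → ¬ Squarefree (W.conductorNorm ℤ) →
      ∀ ⦃N : ℕ⦄ [NeZero N] (f : CuspForm (CongruenceSubgroup.Gamma0 N) 2), IsNewformOf W f →
      ∀ (W₀ : WeierstrassCurve ℚ) [W₀.IsElliptic] [W₀.IsGloballyMinimal], IsNewformOf W₀ f →
      ∀ (L₀ : PeriodPair), IsNeronLatticeOf (W₀.baseChange ℂ) L₀ → ∀ (q : ℚ), q ≠ 0 →
      (∀ z ∈ periodLattice f, (q : ℂ) * z ∈ L₀.lattice) → (∀ z ∈ L₀.lattice, ∃ w ∈ periodLattice f, z = (q : ℂ) * w) →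
      ∃ x₀ : ℚ, HasRationalTwoTorsionX W₀ x₀ ∧ TwoTorsionOdd W₀ x₀ ∧ ¬ TwoTorsionRamifiedAtTwo x₀) :
    Summit.BirchSwinnertonDyer.BirchSwinnertonDyer.Theses.EisensteinDepletionAtTwo.DepletedLambdaLawAtTwoModNSF := by
  intro _ W _ _ x hord hx hAB hnsf N _ f hf c L₀ hL₀ hι S hS hSN
  exact depletedLambdaLawAtTwoAt_of_star W (hG W) (fun x hord hx hAB h15 ↦ hO W x hord hx hAB h15 hnsf) x hord hx hAB f hf c L₀
    hL₀ hι S hS hSN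

/-- **Item stmt-BirchSwinnertonDyer-27048 (glue): `StarGO2Sigma → StarOptBNSF → DepletedLambdaLawAtTwoModNSF` HOLDS** — the route
decls unfold to the displayed bodies of `depletedLambdaLawAtTwoModNSF_of_starNSF`. [cite: GreenbergVatsal2000, §3 Thm. (3.12), display (28)]
[cite: MazurTateTeitelbaum1986Invent, §I.10–I.13] -/
theorem depletedLambdaLawAtTwoModNSFOfStar_proof :
    Summit.BirchSwinnertonDyer.BirchSwinnertonDyer.Theses.EisensteinDepletionAtTwo.DepletedLambdaLawAtTwoModNSFOfStar := by
  unfold Summit.BirchSwinnertonDyer.BirchSwinnertonDyer.Theses.EisensteinDepletionAtTwo.DepletedLambdaLawAtTwoModNSFOfStar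
  intro hG hO
  exact depletedLambdaLawAtTwoModNSF_of_starNSF (fun W _ _ W₀ _ _ ↦ hG W W₀) (fun W _ _ x ↦ hO W x)

/-- **The route child `StarGO2Sigma` (item 27046) IS the Theorems statement of p611861** (`DepletionAtTwo.StarGO2Sigma`), verbatim.
[cite: Vatsal2005, §1.5] -/
theorem starGO2Sigma_iff :
    Summit.BirchSwinnertonDyer.BirchSwinnertonDyer.Theses.EisensteinDepletionAtTwo.StarGO2Sigma ↔ Summit.BirchSwinnertonDyer.BirchSwinnertonDyer.Theorems.DepletionAtTwo.StarGO2Sigma :=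
  Iff.rfl

/-- **The aside `StarOptB` (item 24445, all levels off `15`) implies the child `StarOptBNSF` (item 27047)** — one binder dropped.
[cite: Vatsal2005, Thm. 1.10] -/
theorem starOptBNSF_of_starOptB (h : Summit.BirchSwinnertonDyer.BirchSwinnertonDyer.Theses.EisensteinDepletionAtTwo.StarOptB) :
    Summit.BirchSwinnertonDyer.BirchSwinnertonDyer.Theses.EisensteinDepletionAtTwo.StarOptBNSF :=
  fun W _ _ x hord hx hAB h15 _ ↦ h W x hord hx hAB h15

/-- **The banked aside E1M (item 20341) implies the re-targeted crux E1M_NSF (item 27021)** — restriction of the carrier class, recorded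
so that any closure of the star line's original target still closes the route's load-bearing crux. [cite: GreenbergVatsal2000, §3 Thm. (3.12)] -/
theorem depletedLambdaLawAtTwoModNSF_of_depletedLambdaLawAtTwoMod (h : Summit.BirchSwinnertonDyer.BirchSwinnertonDyer.Theses.EisensteinDepletionAtTwo.DepletedLambdaLawAtTwoMod) :
    Summit.BirchSwinnertonDyer.BirchSwinnertonDyer.Theses.EisensteinDepletionAtTwo.DepletedLambdaLawAtTwoModNSF :=
  fun hmod W _ _ x hord hx hAB _ ↦ h hmod W x hord hx hAB

/-- **E1M_NSF from the UNRESTRICTED Theorems-side children `DepletionAtTwo.StarGO2Sigma` ∧ `StarOptB`** (a fortiori).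
[cite: GreenbergVatsal2000, §3 Thm. (3.12), display (28)] -/
theorem depletedLambdaLawAtTwoModNSF_of_starGO2Sigma_starOptB (hG : Summit.BirchSwinnertonDyer.BirchSwinnertonDyer.Theorems.DepletionAtTwo.StarGO2Sigma) (hO : Summit.BirchSwinnertonDyer.BirchSwinnertonDyer.Theses.EisensteinDepletionAtTwo.StarOptB) :
    Summit.BirchSwinnertonDyer.BirchSwinnertonDyer.Theses.EisensteinDepletionAtTwo.DepletedLambdaLawAtTwoModNSF :=
  depletedLambdaLawAtTwoModNSF_of_starNSF (fun W _ _ W₀ _ _ ↦ hG W W₀) (fun W _ _ x hord hx hAB h15 _ ↦ hO W x hord hx hAB h15)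

/-- **Sanity / by-name recovery of the unrestricted glue p611861** from the pointwise one (`P := ⊤`): the binder orders of §1 are exactly
those of the route items. [cite: GreenbergVatsal2000, §3 Thm. (3.12), display (28)] -/
theorem depletedLambdaLawAtTwoMod_of_starGO2Sigma' (hG : Summit.BirchSwinnertonDyer.BirchSwinnertonDyer.Theorems.DepletionAtTwo.StarGO2Sigma) (hO : Summit.BirchSwinnertonDyer.BirchSwinnertonDyer.Theses.EisensteinDepletionAtTwo.StarOptB) :
    Summit.BirchSwinnertonDyer.BirchSwinnertonDyer.Theses.EisensteinDepletionAtTwo.DepletedLambdaLawAtTwoMod :=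
  fun _ W _ _ ↦ depletedLambdaLawAtTwoOn_of_star (fun _ ↦ True) (fun W _ _ _ W₀ _ _ ↦ hG W W₀) (fun W _ _ _ ↦ hO W) W trivial

/-! ## §3. The glue of the planned RESPLIT of E1M_NSF into `StarGO2SigmaNSF` ∧ `StarOptBNSF` (tenure p2 GEN 31 → GEN 32, memo
HOME/p2/g31/SIGMA-NSF-UNTWIST.md §4(a)) — appended by the lead, GEN 6 -/

/-- **E1M_NSF BY NAME from (★-GO₂^Σ) RESTRICTED TO NON-SQUAREFREE CONDUCTORS and (★-OptB_NSF).**  The first hypothesis is the body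
of the route child `StarGO2Sigma` (item 27046) with the two binders `W.conductorNorm ℤ ≠ 15 → ¬ Squarefree (W.conductorNorm ℤ) →`
inserted right after `IsOrdinaryAt W 2 →` (the carrier-level hypotheses; this is the intended text of the re-split child `StarGO2SigmaNSF`
— weaker than `StarGO2Sigma`, certified class-by-class by eng-2's CERT5 at NSF levels, and at NSF levels the twist `e` is even
identically on paper, memo SIGMA-NSF-UNTWIST.md); the second is the route child `StarOptBNSF` (item 27047) by name.  At a carrier with
`¬ Squarefree N_W` (so `N_W ≠ 15`, as `15 = 3·5` is squarefree) both children are fed at `W` to the pointwise glue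
`depletedLambdaLawAtTwoAt_of_star`; the modularity antecedent is unused.  Candidate `--glue` proof of the re-split.
[cite: GreenbergVatsal2000, §3 Thm. (3.12), display (28)] [cite: Vatsal2005, Thm. 1.1, §1.5] -/
theorem depletedLambdaLawAtTwoModNSF_of_starGO2SigmaNSF_starOptBNSF
    (hG : ∀ (W : WeierstrassCurve ℚ) [W.IsElliptic] [W.IsGloballyMinimal] (W₀ : WeierstrassCurve ℚ) [W₀.IsElliptic] [W₀.IsGloballyMinimal]
      ⦃N : ℕ⦄ [NeZero N] (f : CuspForm (CongruenceSubgroup.Gamma0 N) 2), IsNewformOf W f → IsNewformOf W₀ f → IsOrdinaryAt W 2 →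
      W.conductorNorm ℤ ≠ 15 → ¬ Squarefree (W.conductorNorm ℤ) →
      ∀ (L₀ : PeriodPair), IsNeronLatticeOf (W₀.baseChange ℂ) L₀ → ∀ (q : ℚ), q ≠ 0 →
      (∀ z ∈ periodLattice f, (q : ℂ) * z ∈ L₀.lattice) → (∀ z ∈ L₀.lattice, ∃ w ∈ periodLattice f, z = (q : ℂ) * w) →
      ∀ (x₀ : ℚ), HasRationalTwoTorsionX W₀ x₀ → ¬ TwoTorsionRamifiedAtTwo x₀ →
      ∀ (lam : ℂ), lam ∈ L₀.lattice → lam / 2 ∉ L₀.lattice → L₀.weierstrassP (lam / 2) - ((W₀.b₂ : ℚ) : ℂ) / 12 = ((x₀ : ℚ) : ℂ) →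
      (∃ β : ℕ → ℕ, IsAdmissibleStabData (W.conductorNorm ℤ) β) →
      ∃ β : ℕ → ℕ, IsAdmissibleStabData (W.conductorNorm ℤ) β ∧ ∃ g' : ℚ, g' ≠ 0 ∧ ∃ e : ℤ → ℤ,
      (∀ b d : ℤ, 0 < d → Int.gcd d (b * (W.conductorNorm ℤ : ℕ)) = 1 →
      ∃ n' : ℤ, stabEisensteinPeriod (W.conductorNorm ℤ) β (Int.gcdA d (b * (W.conductorNorm ℤ : ℕ))) b
      (-((W.conductorNorm ℤ : ℕ) : ℤ) * Int.gcdB d (b * (W.conductorNorm ℤ : ℕ))) d = n' * g' ∧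
      (Even n' ↔ ((∃ k : ℤ, ∃ w ∈ L₀.lattice,
      (q : ℂ) * (modularSymbol f ((b : ℚ) / (d : ℚ)) - modularSymbol f 0) = (k : ℂ) * lam + 2 * w) ↔ Even (e d)))) ∧
      (∃ b d : ℤ, 0 < d ∧ Int.gcd d (b * (W.conductorNorm ℤ : ℕ)) = 1 ∧
      ∃ n' : ℤ, stabEisensteinPeriod (W.conductorNorm ℤ) β (Int.gcdA d (b * (W.conductorNorm ℤ : ℕ))) b
      (-((W.conductorNorm ℤ : ℕ) : ℤ) * Int.gcdB d (b * (W.conductorNorm ℤ : ℕ))) d = n' * g' ∧ Odd n'))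
    (hO : Summit.BirchSwinnertonDyer.BirchSwinnertonDyer.Theses.EisensteinDepletionAtTwo.StarOptBNSF) :
    Summit.BirchSwinnertonDyer.BirchSwinnertonDyer.Theses.EisensteinDepletionAtTwo.DepletedLambdaLawAtTwoModNSF := by
  intro _ W _ _ x hord hx hAB hnsf N _ f hf c L₀ hL₀ hι S hS hSN
  have h15 : W.conductorNorm ℤ ≠ 15 := fun h ↦ hnsf (by
    rw [h, show (15 : ℕ) = 3 * 5 by norm_num, Nat.squarefree_mul_iff]
    exact ⟨by norm_num, Nat.prime_three.prime.squarefree, Nat.prime_five.prime.squarefree⟩)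
  refine depletedLambdaLawAtTwoAt_of_star W ?_ (fun x hord hx hAB h15' ↦ hO W x hord hx hAB h15' hnsf)
    x hord hx hAB f hf c L₀ hL₀ hι S hS hSN
  intro W₀ _ _ N' _ f' hf' hf₀ hord'
  exact hG W W₀ f' hf' hf₀ hord' h15 hnsf

end DepletionAtTwo

end Summit.BirchSwinnertonDyer.BirchSwinnertonDyer.Theorems

end
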